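import Summits.BirchSwinnertonDyer.BirchSwinnertonDyer.Theorems.PrintX8SharpFlatMuTransfer
import Summits.BirchSwinnertonDyer.BirchSwinnertonDyer.Theorems.PrintX8MazurTateMuRider
import Summits.BirchSwinnertonDyer.Rank1Residual.Supersingular.X8SharpFlatKatoUpperHalf
import Summits.BirchSwinnertonDyer.Rank1Residual.Additive.TameBranchBudgetSqueeze
import Summits.BirchSwinnertonDyer.Rank1Residual.X11a.MuLambdaSplit
import HarnessLib

/-!
# Route `PrintX8`, crux `MuBoundSmallImageX8` (stmt-BirchSwinnertonDyer-20622), ANALYTIC RANK `0`: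
# on the small-image X8 pairs with `3 ∤ #Ш_an` the EXACT missing input is the UPPER bound ALONE — and
# the cell's line (one colour of unit content + the reduction-free core) supplies it integrally:
# `BSD(E,3)` and Sprung's Main Conjecture 7.21 for that colour, K1-FREE
# (cell `bsd-print-x8`, D-0131 (2) print tier, seat p3 gen 2 «does BSTW 2024 cover a_p ≠ 0 at p = 3?
# NO ⇒ the exact missing input is the crux»; `--supports` 20622; theorems only, closes nothing)

PARTITION (cell bsd-print-x8, leaf `ClassX8` = K3 row A8 = W-ALL row 8; 217 census cells, 61 with image
`N_ns⁺(3)`): per-pair and class theorems CONDITIONAL on published named facts + ONE displayed analytic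
rider per pair; closes NONE; 0 census cells move by class theorem; BSD is not proved by any of this.
beyond-print theorem: YES — an INTEGRAL Kato-side bound `ord₃ #Ш ≤ ord₃ #Ш_an` at NON-surjective
`3`-adic image (Kato's (12.5.2) fails on all 61 cells: image ∩ SL₂(𝔽₃) = Q₈), from the rider.

HONEST FRAMING. Seat p3's sentence, NO-branch, applied one level below p3 g1's `μ`-split (the exact
missing input of 20402 beyond K1 is the `μ`-bound 20622): on the 61 small-image cells the route asks for
K1 (19875, the Eisenstein LOWER half, no engine in print at `a₃ = ±3`) AND Mu. But at analytic rank `0`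
Miller's `BSD(E,3)` is `ord₃ #Ш = ord₃ #Ш_an` (`E(ℚ)[3] = 0` on X8, `E[3]` irreducible), and when
`3 ∤ #Ш_an` the LOWER half `ord₃ #Ш_an ≤ ord₃ #Ш` is VACUOUS. So on those pairs the exact missing input is
NOT K1 and NOT the full `μ`-bound: it is the integral UPPER half only, which Wuthrich 2014 Prop. 21 /
Kato Thm. 12.5 (4) / Sprung 2012 Thm. 7.16 (`n = 0`) print ONLY under `3`-adic surjectivity — false on all
61 cells. The cell's line supplies it: ONE colour `•` of the Sprung pair with a `3`-adic unit coefficient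
(`HasUnitContent (L^•_3(E))`, the analytic rider; per pair ONE certified Mazur–Tate layer, p3 g1
`PrintX8MazurTateMuRider.ClassX8.exists_chromaticL_muZero_of_mazurTate`; census 61/61) ⟹ `μ(X^•) = 0`
(p1 g2 `PrintX8SharpFlatMuTransfer.X8.sharpFlatMu_eq_zero`: Sprung 2012 Def. 6.1 / Thm. 7.14 (3) package
`hCK` + Kato Thm. 12.6 span clause + the reduction-free core `coreOdd_anyReduction_holds` at non-surjective
image) ⟹ Sprung 2012 Thm. 7.16's RATIONAL clause `ξ ∣ 3ⁿ L^•` is INTEGRAL, `ξ ∣ L^•` (Gauss' lemma for the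
prime `3 ∈ Λ`, §1) ⟹ Sprung 2024 Lemmas 5.5–5.9 (all `N`) + Prop. 6.14 + period unit at `3` ⟹
`ord₃ #Ш ≤ ord₃ #Ш_an` (p2's chain `missingUpperBoundAt_of_chromaticUpperDivisibility`).

CENSUS READING (ty3 `HOME/ty3/data/x8_smallimage_61cells.tsv`, columns `rank`, `ord3Sha`): of the 61
small-image cells, **54** have `r_an = 0` and `ord₃ #Ш_an = 0` (52 with `ord₃ ∏c_ℓ ≥ 1`, 2 unit cells
135200bx1 / 442225bz1 = p1 g2's `PrintX8SharpFlatMuTransferUnit`; census kinds: 48 `X8~` compute-only,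
6 `X8`); on each of them §2 gives `BSD(E,3)` and part 2 gives Main Conj. 7.21 for the unit-content
colour(s) from PUBLISHED named facts + `hCK` + ONE Mazur–Tate layer certificate + the `#Ш_an` certificate
— NO K1, NO congruence partner, NO `Surj`. The other 7: 116032by1, 364658br1, 372416dm1, 474320e1,
493790v1 (`#Ш_an = 9`), 288800cu1 (`#Ш_an = 81`) — §2 reduces them to `MissingLowerBoundAt W 3` (K1, or
a `3`- or `9`-descent certificate + Cassels–Tate); 478400hc1 (`r_an = 1`) — untouched (♯/♭ `p`-adic GZ).

PRIOR ART IN THE TREE (per pair, same 54 cells): `Supersingular/NonsplitCartanThreeDescentRecordsX8Three01–05.lean`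
(cell b2b-bsdres, additive-p3 GEN 18): `BSD(E,3)` per pair on the `3Nn` rows with `3 ∤ #Ш_an` from GZK and ONE
EXACT `3`-descent line `#Sel³(E/ℚ) = 3^{r_an}` (Schaefer–Stoll in the octic algebra `ℚ[x]/(ψ₃)`, kit
j131863; `Typed.bsdp_of_card_selmerGroup_eq_pow_analyticRank`, image-free, elementary). So `BSD(E,3)` PER
PAIR on these cells is NOT new. What THIS file adds: (i) an independent, Iwasawa-theoretic road whose
per-pair certificate is one Mazur–Tate layer (modular symbols mod `3`) instead of a certified octic class
group; (ii) the CLASS-LEVEL statement at non-surjective image (the upper half on X8 ∩ {¬surj(3)} ∩ {r_an = 0}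
modulo the one-colour rider, part 2 §4) — descent certificates have no class form; (iii) part 2 §3: the
`Λ`-adic content unreachable by descent — Sprung's Main Conj. 7.21 and K1's predicate at the pair from
`BSD(E,3)` (EITHER source) + the rider.

## Contents (theorems only; every non-published input a DISPLAYED binder)

* §1 `sharpFlatUpper_dvd_of_muInvariant_eq_zero` — Λ-algebra, image-free: `char X^• = (ξ)`,
  `μ(X^•) = 0`, Sprung 2012 Thm. 7.16 RATIONAL clause ⟹ `ξ ∣ L^•` (♯/♭ twin of K3's
  `signedUpper_dvd_of_hasUnitContent`).
* §2 PER PAIR, X8 ∧ `¬ Surj W 3` ∧ `r_an = 0`, colour `•` with unit content: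
  `X8.missingUpperBoundAt_of_hasUnitContent_of_not_surj_of_analyticRank_eq_zero` (the UPPER half);
  `X8.bsdp_of_hasUnitContent_of_shaAn_le_…` (`ord₃ #Ш_an ≤ 0` ⟹ `BSD(E,3)`);
  `X8.bsdp_of_hasUnitContent_of_missingLowerBoundAt_…` (the 6 cells with `3 ∣ #Ш_an`);
  `X8.bsdp_of_mazurTate_of_shaAn_le_…` (the per-cell consumer: ONE certified Mazur–Tate layer).
* Part 2 (`PrintX8SmallImageRiderMainConjecture.lean`, same seat): §3 PER PAIR, the ♯/♭ MAIN CONJECTURE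
  K1-free (`BSD(E,3)` + rider for `•` ⟹ Main Conj. 7.21 for `•`, image-free twin of K3's
  `kobayashiMainConjecture_of_mu_eq_zero_of_bsdp_of_analyticRank_eq_zero`; hence K1's predicate at the
  pair); §4 CLASS FORMS on X8 ∩ {¬surj(3)} ∩ {r_an = 0} ∩ {3 ∤ #Ш_an} (54 census cells).

What is NOT here: any class-wide source of the rider (Perrin-Riou 2003 Conj. 7.1 via Sprung 2017 Cor.
3.6 — OPEN; per pair decidable); K1; the rank-one cell; anything booked. Item 20622 stays OPEN.
References: [Sprung2012] Def. 6.1, Prop. 6.14, Thm. 7.14, Thm. 7.16, Main Conj. 7.21 (pp. 1495–1505);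
[Sprung2024] §5.2 Lemmas 5.5–5.9; [Sprung2017] Thm. 1.12, §3.1, Cor. 4.4/4.11; [Kato2004Asterisque] Thm.
12.5 (12.5.2), Thm. 12.6; [PerrinRiou2003] Conj. 7.1; [GreenbergVatsal2000] p. 2 (1)–(2), §3 Rem. 3.4;
[Washington1997] §7.1, §13.2; [Miller2011LMS] Def. 1.1; tree: p2 `X8SharpFlatKatoUpperHalf` (p540191), p1 g2
`PrintX8SharpFlatMuTransfer(Unit)` (p545102/p545480), p3 g1 `PrintX8MazurTateMuRider` (p546221), K3
`…SmallImageMuSaturation`.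
-/

set_option autoImplicit false
-- justification: the mandated namespace `Summit.BirchSwinnertonDyer.BirchSwinnertonDyer.Theorems`
-- (single-conjunct summit, Sub = Summit) repeats a segment by design (D-0017).
set_option linter.dupNamespace false

noncomputable section

open scoped Classical NumberField MatrixGroups ModularForm

open NumberField IsDedekindDomain WeierstrassCurve CongruenceSubgroup Field
  Literature.NumberTheory.EllipticCurves Literature.NumberTheory.EllipticCurves.ModularForms
  Literature.NumberTheory.EllipticCurves.Rank1Residual
  Literature.NumberTheory.EllipticCurves.Rank1Residual.Typed
  Literature.NumberTheory.EllipticCurves.Sprung2017 Literature.NumberTheory.EllipticCurves.Sprung2012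
  Literature.NumberTheory.EllipticCurves.Sprung2024
  Literature.NumberTheory.EllipticCurves.GreenbergVatsal2000
  Literature.NumberTheory.EllipticCurves.ZpExtension
  Summit.BirchSwinnertonDyer.BirchSwinnertonDyer.Theorems
  Summit.BirchSwinnertonDyer.Rank1Residual.Supersingular
  Summit.BirchSwinnertonDyer.Rank1Residual.X1.MuLambda

namespace Summit.BirchSwinnertonDyer.BirchSwinnertonDyer.Theorems.PrintX8SmallImageRiderRankZero

/-! ### §1 Λ-algebra: Sprung's RATIONAL Kato divisibility is INTEGRAL when `μ(X^•) = 0` -/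

section Upper

variable {W : WeierstrassCurve ℚ} [W.IsElliptic] [W.IsGloballyMinimal] {p : ℕ} [Fact p.Prime]
  {N : ℕ} [NeZero N] {f : CuspForm (Gamma0 N) 2}
  {κ : ZpExtension ℚ p} {γ : absoluteGaloisGroup ℚ} {v : HeightOneSpectrum (𝓞 ℚ)}
  {g : absoluteGaloisGroup (v.adicCompletion ℚ)}
  {cneg : localPoints W (v.adicCompletion ℚ)} {c : ℕ → localPoints W (v.adicCompletion ℚ)}
  {col : Chroma} {Lsharp Lflat : IwasawaAlgebra p}

/-- **`μ(X^•) = 0` makes Sprung 2012 Thm. 7.16 integral, with NO hypothesis on the Galois image.** In the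
cyclotomic / Honda setting of Thm. 7.16, for a colour `•` with `L^• ≠ 0`, a dual datum `D` of
`Sel^•(E/ℚ_∞)` (f.g. torsion), a characteristic power series `ξ` (`char X^• = (ξ)`) and `μ(D.X) = 0`:
**`ξ ∣ L^•_p(E)` in `Λ`.** Proof: `μ(X^•) = 0 ⟺ ξ` has unit content (Greenberg–Vatsal (2),
`muInvariant_eq_zero_iff_hasUnitContent`); Thm. 7.16's RATIONAL clause `ξ ∣ pⁿ·L^•` (tree fact, `exists_dvd_pow_mul`);
Gauss' lemma for the prime `p ∈ Λ = ℤ_p⟦T⟧` (`Additive.dvd_of_dvd_C_pow_mul_of_hasUnitContent`). The ♯/♭ twin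
of K3's `signedUpper_dvd_of_hasUnitContent`. [cite: Sprung2012, Thm. 7.16 (p. 1504)]
[cite: GreenbergVatsal2000, p. 2, (1)–(2)] [cite: Washington1997, §7.1 and §13.2] -/
theorem sharpFlatUpper_dvd_of_muInvariant_eq_zero (h716 : thm716_sharpFlatCharIdeal_divisibility)
    (hp : p ≠ 2) (hgood : W.HasGoodReductionAtPrime p) (hap : (p : ℤ) ∣ W.frobeniusTrace p)
    (hf : IsNewformOf W f) (hκ : κ.IsCyclotomic) (hγ : κ.IsTopGenerator γ)
    (hγ' : IsCyclotomicVariable p γ) (hv : (p : 𝓞 ℚ) ∈ v.asIdeal)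
    (hg : κ.IsTopGenerator (resGalOfEmb (closureEmb (K := ℚ) (v.adicCompletion ℚ)) g))
    (hH : IsHondaSystem κ (closureEmb (K := ℚ) (v.adicCompletion ℚ)) W (W.frobeniusTrace p) g cneg c)
    (hSP : IsSprungPair f p (W.frobeniusTrace p) Lsharp Lflat) (hL0 : chromaticL col Lsharp Lflat ≠ 0)
    (D : SharpFlatSelmerDualData W κ γ (closureEmb (K := ℚ) (v.adicCompletion ℚ))
      (W.frobeniusTrace p) g c col) [Module.Finite (IwasawaAlgebra p) D.X]
    (hX : Module.IsTorsion (IwasawaAlgebra p) D.X)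
    {ξ : IwasawaAlgebra p} (hξ : D.charIdeal = Ideal.span {ξ}) (hμ : muInvariant p D.X = 0) :
    ξ ∣ chromaticL col Lsharp Lflat := by
  have hu : HasUnitContent ξ := (muInvariant_eq_zero_iff_hasUnitContent D.X hX hξ).mp hμ
  obtain ⟨n, hn⟩ := h716.exists_dvd_pow_mul hp hgood hap hf hκ hγ hγ' hv hg hH hSP hL0 D hX hξ
  have hC : ((p : IwasawaAlgebra p) ^ n : IwasawaAlgebra p) = PowerSeries.C ((p : ℤ_[p]) ^ n) := by
    rw [map_pow, map_natCast]
  rw [hC] at hn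
  exact Summit.BirchSwinnertonDyer.Rank1Residual.Additive.dvd_of_dvd_C_pow_mul_of_hasUnitContent hu n hn

end Upper

/-! ### §2 PER PAIR, X8 ∧ `ρ̄_{E,3}` NOT onto ∧ `r_an = 0`: the UPPER half from ONE colour of unit content -/

section PerPair

variable (W : WeierstrassCurve ℚ) [W.IsElliptic] [W.IsGloballyMinimal] (p : ℕ) [Fact p.Prime]

/-- **X8 ∧ `¬ surj(3)` ∧ `r_an = 0`, colour `•` with unit content: `ord₃ #Ш ≤ ord₃ #Ш_an`.** Let `(W, 3)`
be an X8 pair (good supersingular, `a₃ = ±3`) with `ρ̄_{E,3}` NOT onto and `ord_{s=1} L(E,s) = 0`, `f` a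
newform of `W`, `(L♯, L♭)` the Sprung pair of `f` and `•` a colour whose member has a `3`-adic UNIT
coefficient (`hu`, the analytic rider «`μ(L^•_3(E)) = 0`»). Named inputs (published, BY NAME): Sprung 2012
Thm. 2.2 (`h22`), Thm. 7.14 (`h714`), Thm. 7.16 RATIONAL clause (`h716`), the ♯/♭ Coleman–Kato package
(`hCK`, Def. 6.1 / Thm. 7.14 (3) / Kato 12.6), Sprung 2024 §5.2 Lemmas 5.5–5.9 all `N` (`h59`), the period
unit at `3` (`h3`), GZK (`hGZK`), entire continuation (`hmod`). Chain: the cyclotomic/Honda setting and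
the REAL `X^•`; `μ(X^•) = 0` (p1 g2 `X8.sharpFlatMu_eq_zero`, the reduction-free core at non-surjective
image); §1 ⟹ `ξ ∣ L^•` integrally; (K•) + unit-normalised interpolation ⟹ the upper half (p2
`missingUpperBoundAt_of_chromaticUpperDivisibility`). NO `Surj`, NO K1, NO partner. PER PAIR; conditional
on the named facts and the rider; closes nothing.
[cite: Sprung2012, Def. 6.1 (p. 1495), Thm. 2.2, Prop. 6.14, Thm. 7.14, Thm. 7.16 (p. 1504)]
[cite: Sprung2024, §5.2 Lemmas 5.5–5.9 (pp. 40–41)] [cite: Kato2004Asterisque, Thm. 12.6 (p. 222)]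
[cite: Miller2011LMS, Def. 1.1] -/
theorem X8.missingUpperBoundAt_of_hasUnitContent_of_not_surj_of_analyticRank_eq_zero
    (h22 : thm22_exists_isHondaSystem) (h714 : thm714_sharpFlatSelmerDual_finite_torsion)
    (h716 : thm716_sharpFlatCharIdeal_divisibility) (hCK : thm714seq_sharpFlatColemanKato_zeta)
    (h59 : lem59AllN_sharpFlatCharValue_rankZero) (h3 : realPeriodRat_eq_unit_mul_plusPeriod_three)
    (hGZK : rank_eq_analyticRank_of_analyticRank_le_one) (hmod : hasEntireLFunction_rat)
    (hX : ClassX8 W p) (hns : ¬ Surj W p) (h0 : W.analyticRank = 0)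
    {N : ℕ} [NeZero N] {f : CuspForm (Gamma0 N) 2} (hf : IsNewformOf W f)
    {Lsharp Lflat : IwasawaAlgebra p} (hSP : IsSprungPair f p (W.frobeniusTrace p) Lsharp Lflat)
    (col : Chroma) (hu : HasUnitContent (chromaticL col Lsharp Lflat)) : MissingUpperBoundAt W p := by
  have hp3 : p = 3 := hX.1
  subst hp3
  have hp2 : (3 : ℕ) ≠ 2 := by decide
  have hgood : W.HasGoodReductionAtPrime 3 := hX.2.1.1
  have hdvd : ((3 : ℕ) : ℤ) ∣ W.frobeniusTrace 3 := hX.2.1.2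
  have hirr : W.HasIrreducibleModPGaloisRep 3 := ClassX8.irr W 3 hX
  have hL : W.entireLFunction 1 ≠ 0 := (W.analyticRank_eq_zero_iff_holds (hmod W)).1 h0
  have hcol : chromaticL col Lsharp Lflat ≠ 0 :=
    Summit.BirchSwinnertonDyer.Rank1Residual.X11a.ne_zero_of_hasUnitContent hu
  -- the cyclotomic setting, the place above `3`, the local lift, a Honda system (Thm. 2.2)
  obtain ⟨κ, hκ, γ, hγ, hγ'⟩ := exists_isCyclotomic_isTopGenerator_isCyclotomicVariable_holds 3
  obtain ⟨v, hv⟩ :=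
    Literature.NumberTheory.NumberFields.RingOfIntegers.exists_heightOneSpectrum_natCast_mem ℚ
      (p := 3) (by norm_num)
  obtain ⟨g, hg⟩ := hκ.exists_isTopGenerator_resGalOfEmb_adicCompletion v hv
  obtain ⟨cneg, c, hc⟩ := h22 W 3 hp2 hgood hdvd κ γ hκ hγ hγ' v hv g hg
  -- the REAL `X^•`, finitely generated torsion (Thm. 7.14), a generator of its characteristic ideal
  let D := sharpFlatSelmerDualData W κ (closureEmb (K := ℚ) (v.adicCompletion ℚ))
    (W.frobeniusTrace 3) g c col hγ
  obtain ⟨hfinD, htorD⟩ :=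
    h714 W 3 hp2 hgood hdvd f hf κ γ hκ hγ hγ' v hv g hg cneg c hc col Lsharp Lflat hSP hcol D
  haveI := hfinD
  obtain ⟨gen, hgen⟩ := (charIdeal_isPrincipal_holds 3 D.X).principal
  have hchar : D.charIdeal = Ideal.span {gen} := hgen
  -- (K•): the ♯/♭ control / Euler characteristic (Sprung 2024 Lemmas 5.5–5.9, all levels)
  have hK : (⟨gen, 0, 0⟩ : SignedDatum W 3).EulerCharacteristic := fun hfin =>
    h59 W 3 hp2 hgood hdvd hL κ γ hκ hγ hγ' v hv g hg cneg c hc col D htorD gen hchar hfin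
  -- a period ratio for `f` (period unit at `3`), then `μ(X^•) = 0` from the rider through the core
  obtain ⟨u, hu1, hΩ⟩ := h3 W hgood hirr f hf
  have hu0 : (u : ℝ) ≠ 0 := by
    intro h
    have h0' : u = 0 := by exact_mod_cast h
    rw [h0'] at hu1
    simp at hu1
  have hϖ : ((u⁻¹ : ℚ) : ℝ) * W.realPeriodRat = plusPeriod f := by
    rw [hΩ, Rat.cast_inv, ← mul_assoc, inv_mul_cancel₀ hu0, one_mul]
  have hμ : muInvariant 3 D.X = 0 :=
    PrintX8SharpFlatMuTransfer.X8.sharpFlatMu_eq_zero W 3 hCK h3 hX hns f hf u⁻¹ hϖ κ γ hκ hγ hγ' v hv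
      g hg cneg c hc col hSP hu D
  -- §1: Kato through the ♯/♭ Coleman maps is INTEGRAL
  have hKato : gen ∣ chromaticL col Lsharp Lflat :=
    sharpFlatUpper_dvd_of_muInvariant_eq_zero h716 hp2 hgood hdvd hf hκ hγ hγ' hv hg hc hSP hcol D htorD
      hchar hμ
  exact missingUpperBoundAt_of_chromaticUpperDivisibility W 3 hGZK hp2 hgood hirr hL hf
    (h3 W hgood hirr f hf) hSP col (ClassX8.not_dvd_chromaticConst' W 3 hX col) gen hK hKato

/-- **X8 ∧ `¬ surj(3)` ∧ `r_an = 0`, unit-content colour, `ord₃ #Ш_an ≤ 0` ⟹ `BSD(E,3)`** — the LOWER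
half is vacuous when `3 ∤ #Ш_an`, the upper half is the previous theorem. On the census: 54 of the 61
small-image cells. NO K1. PER PAIR; conditional; closes nothing.
[cite: Sprung2012, Thm. 7.14 and Thm. 7.16 (p. 1504)] [cite: Sprung2024, §5.2 Lemmas 5.5–5.9]
[cite: Miller2011LMS, §1 and Def. 1.1] -/
theorem X8.bsdp_of_hasUnitContent_of_shaAn_le_of_not_surj_of_analyticRank_eq_zero
    (h22 : thm22_exists_isHondaSystem) (h714 : thm714_sharpFlatSelmerDual_finite_torsion)
    (h716 : thm716_sharpFlatCharIdeal_divisibility) (hCK : thm714seq_sharpFlatColemanKato_zeta)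
    (h59 : lem59AllN_sharpFlatCharValue_rankZero) (h3 : realPeriodRat_eq_unit_mul_plusPeriod_three)
    (hGZK : rank_eq_analyticRank_of_analyticRank_le_one) (hmod : hasEntireLFunction_rat)
    (hX : ClassX8 W p) (hns : ¬ Surj W p) (h0 : W.analyticRank = 0)
    {N : ℕ} [NeZero N] {f : CuspForm (Gamma0 N) 2} (hf : IsNewformOf W f)
    {Lsharp Lflat : IwasawaAlgebra p} (hSP : IsSprungPair f p (W.frobeniusTrace p) Lsharp Lflat)
    (col : Chroma) (hu : HasUnitContent (chromaticL col Lsharp Lflat))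
    (hsha : ∃ q : ℚ, shaAn W = (q : ℂ) ∧ padicValRat p q ≤ 0) : BSDp W p := by
  refine bsdp_of_missingPPartAt W p hGZK (by omega) (missingPPartAt_of_lower_of_upper W p ?_
    (X8.missingUpperBoundAt_of_hasUnitContent_of_not_surj_of_analyticRank_eq_zero W p h22 h714 h716 hCK
      h59 h3 hGZK hmod hX hns h0 hf hSP col hu))
  obtain ⟨q, hq, hle⟩ := hsha
  exact ⟨q, hq, hle.trans (by exact_mod_cast Nat.zero_le _)⟩

/-- **X8 ∧ `¬ surj(3)` ∧ `r_an = 0`, unit-content colour, LOWER half displayed ⟹ `BSD(E,3)`** — for the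
6 rank-`0` small-image cells with `3 ∣ #Ш_an` the missing input shrinks to `MissingLowerBoundAt W 3`
(K1 at the pair, or a `3`-descent certificate with Cassels–Tate). PER PAIR; conditional; closes nothing.
[cite: Sprung2012, Thm. 7.16 (p. 1504)] [cite: Sprung2024, §5.2 Lemmas 5.5–5.9] [cite: Miller2011LMS, §1 and Def. 1.1] -/
theorem X8.bsdp_of_hasUnitContent_of_missingLowerBoundAt_of_not_surj_of_analyticRank_eq_zero
    (h22 : thm22_exists_isHondaSystem) (h714 : thm714_sharpFlatSelmerDual_finite_torsion)
    (h716 : thm716_sharpFlatCharIdeal_divisibility) (hCK : thm714seq_sharpFlatColemanKato_zeta)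
    (h59 : lem59AllN_sharpFlatCharValue_rankZero) (h3 : realPeriodRat_eq_unit_mul_plusPeriod_three)
    (hGZK : rank_eq_analyticRank_of_analyticRank_le_one) (hmod : hasEntireLFunction_rat)
    (hX : ClassX8 W p) (hns : ¬ Surj W p) (h0 : W.analyticRank = 0)
    {N : ℕ} [NeZero N] {f : CuspForm (Gamma0 N) 2} (hf : IsNewformOf W f)
    {Lsharp Lflat : IwasawaAlgebra p} (hSP : IsSprungPair f p (W.frobeniusTrace p) Lsharp Lflat)
    (col : Chroma) (hu : HasUnitContent (chromaticL col Lsharp Lflat))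
    (hlow : MissingLowerBoundAt W p) : BSDp W p :=
  bsdp_of_missingPPartAt W p hGZK (by omega) (missingPPartAt_of_lower_of_upper W p hlow
    (X8.missingUpperBoundAt_of_hasUnitContent_of_not_surj_of_analyticRank_eq_zero W p h22 h714 h716 hCK
      h59 h3 hGZK hmod hX hns h0 hf hSP col hu))

/-- **The per-cell consumer: ONE certified Mazur–Tate layer + `ord₃ #Ш_an ≤ 0` ⟹ `BSD(E,3)`** on X8 ∧
`¬ surj(3)` ∧ `r_an = 0`. The layer certificate (`Θ ∈ Λ` with `ι Θ = θ_n(f)`, `Θ ≠ 0`, `μ(Θ) = 0`; any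
parity `n`) gives a colour of unit content by p3 g1's reading
`PrintX8MazurTateMuRider.ClassX8.exists_chromaticL_muZero_of_mazurTate` (Pollack 2003 Props. 6.9/6.10 ∘
Sprung 2017 Cor. 4.4); then the previous theorems. PER PAIR; conditional; closes nothing.
[cite: Pollack2003, Prop. 6.9 and Prop. 6.10] [cite: Sprung2017, §3.1, Cor. 4.4 and Thm. 1.12]
[cite: Sprung2012, Thm. 7.16 (p. 1504)] [cite: Miller2011LMS, §1 and Def. 1.1] -/
theorem X8.bsdp_of_mazurTate_of_shaAn_le_of_not_surj_of_analyticRank_eq_zero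
    (h22 : thm22_exists_isHondaSystem) (h714 : thm714_sharpFlatSelmerDual_finite_torsion)
    (h716 : thm716_sharpFlatCharIdeal_divisibility) (hCK : thm714seq_sharpFlatColemanKato_zeta)
    (h59 : lem59AllN_sharpFlatCharValue_rankZero) (h3 : realPeriodRat_eq_unit_mul_plusPeriod_three)
    (hGZK : rank_eq_analyticRank_of_analyticRank_le_one) (hmod : hasEntireLFunction_rat)
    (hX : ClassX8 W p) (hns : ¬ Surj W p) (h0 : W.analyticRank = 0)
    {N : ℕ} [NeZero N] {f : CuspForm (Gamma0 N) 2} (hf : IsNewformOf W f)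
    {Lsharp Lflat : IwasawaAlgebra p} (hSP : IsSprungPair f p (W.frobeniusTrace p) Lsharp Lflat)
    {n : ℕ} {Θ : IwasawaAlgebra p}
    (hΘ : iwasawaToPowerSeries p Θ =
      ((mazurTateElement f p n).map (algebraMap ℚ ℚ_[p]) : PowerSeries ℚ_[p]))
    (hΘ0 : Θ ≠ 0) (hμΘ : mu Θ = 0)
    (hsha : ∃ q : ℚ, shaAn W = (q : ℂ) ∧ padicValRat p q ≤ 0) : BSDp W p := by
  obtain ⟨col, -, -, hu, -⟩ :=
    PrintX8MazurTateMuRider.ClassX8.exists_chromaticL_muZero_of_mazurTate hX hf hSP hΘ hΘ0 hμΘ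
  exact X8.bsdp_of_hasUnitContent_of_shaAn_le_of_not_surj_of_analyticRank_eq_zero W p h22 h714 h716 hCK
    h59 h3 hGZK hmod hX hns h0 hf hSP col hu hsha

end PerPair

end Summit.BirchSwinnertonDyer.BirchSwinnertonDyer.Theorems.PrintX8SmallImageRiderRankZero

end
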